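import Mathlib.NumberTheory.LocalField.Basic
import Mathlib.NumberTheory.Padics.ValuativeRel
import Mathlib.RingTheory.Valuation.Discrete.Basic
import Mathlib.Analysis.Complex.Basic
import Mathlib.FieldTheory.Finite.Basic
import Mathlib.Data.Int.WithZero
import HarnessLib

-- provenance: harness21/H21/H21/Prelude/GalRep/LocalField.lean @ 7b57685 (interim HEAD d8f2665); M5 mechanical rewrite
/-!
# Local fields (GalRep trunk, prelude C1; notion `local_field`)

A *local field* in the sense of Weil (*Basic Number Theory*, 1967, Ch. I §2–§4) is a
non-discrete locally compact Hausdorff topological field. Such a field is either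
archimedean (`ℝ` or `ℂ`) or non-archimedean (a finite extension of `ℚ_[p]` or of `𝔽_p((t))`);
see also Serre, *Local Fields* (1979), Ch. II §1, and Cassels–Fröhlich, Ch. II §1, §7.

## Mathlib anchors (reused, not redefined)

* `IsNonarchimedeanLocalField F` (`Mathlib.NumberTheory.LocalField.Basic`): a field with a
  `ValuativeRel` whose (valuative) topology is locally compact and non-trivially valued. This is
  THE hypothesis of every non-archimedean statement of the trunk. Mathlib derives
  `Finite 𝓀[F]`, `IsDiscreteValuationRing 𝒪[F]`, `IsTopologicalDivisionRing F` and the order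
  isomorphism
  `IsNonarchimedeanLocalField.valueGroupWithZeroIsoInt F : ValueGroupWithZero F ≃*o ℤᵐ⁰`.
* `Valuation.IsUniformizer` (`Mathlib.RingTheory.Valuation.Discrete.Basic`) for uniformizers. The
  instance `(valuation F).IsRankOneDiscrete` for a non-archimedean local field is found by Mathlib's
  `Valuation.IsRankOneDiscrete.mk'` instance (cyclic, non-trivial value group), so
  `(valuation F).IsUniformizer ϖ` applies directly; nothing is added here.
* `WithZeroMulInt.toNNReal` (`Mathlib.Data.Int.WithZero`) to turn `ℤᵐ⁰` into `ℝ≥0`.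
* `Padic`, with Mathlib's `ValuativeRel ℚ_[p]` (`Mathlib.NumberTheory.Padics.ValuativeRel`).
  Mathlib has NO instance `IsNonarchimedeanLocalField ℚ_[p]`; following the outline (D4) we state
  it as a *theorem* `Padic.isNonarchimedeanLocalField`, never as a (sorried) instance.

## Contents

* `Literature.IsLocalField F`: umbrella Prop-class (Weil's definition).
* `Literature.IsNonarchimedeanLocalField.residueFieldCard F = q_F = Nat.card 𝓀[F]` and its basic facts.
* `Literature.IsNonarchimedeanLocalField.normAbs F : F →*₀ ℝ≥0`, the normalised absolute value
  `|x|_F = q_F ^ (-v_F(x))`, `|ϖ|_F = q_F⁻¹` (Tate, *Number theoretic background*, Corvallis 1979,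
  (1.4.1); Cassels–Fröhlich Ch. II §7).
* Classification / instantiation theorems (proofs `sorry`): `ℝ`, `ℂ`, `ℚ_[p]` are local fields,
  every non-archimedean local field is a local field, and Weil's dichotomy
  `IsLocalField.isNonarchimedean_or_archimedean` (alias `nonarchimedean_or_archimedean`;
  Weil 1967, Ch. I §3, Theorem 5 and §4 Theorem 8).

## Design notes

* `IsLocalField` is an unbundled Prop-valued mixin over `[Field F] [TopologicalSpace F]`,
  extending `T2Space`, `LocallyCompactSpace`, `IsTopologicalDivisionRing`, plus non-discreteness.
* `normAbs_eq_zero` is not stated separately: it is the generic simp lemma `map_eq_zero`.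
* No instances are declared for `ℚ_[p]` or for adic completions (outline GalRep D4).
* Declarations live in `namespace Literature`; the sub-namespaces `Literature.IsNonarchimedeanLocalField`,
  `Literature.NumberTheory.GaloisRepresentations.IsLocalField`, `Literature.Padic` mirror Mathlib's names for discoverability only.
-/

open scoped NNReal Valued
open ValuativeRel

namespace Literature.NumberTheory.GaloisRepresentations

/-! ### The umbrella class -/

/-- A *local field* in the sense of Weil (*Basic Number Theory*, 1967, Ch. I §2): a field with a
Hausdorff, locally compact, non-discrete topology making it a topological division ring
(addition, multiplication and inversion continuous). Examples: `ℝ`, `ℂ`, finite extensions of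
`ℚ_[p]` and `𝔽_q((t))`. [folklore] -/
class IsLocalField (F : Type*) [Field F] [TopologicalSpace F] : Prop
    extends T2Space F, LocallyCompactSpace F, IsTopologicalDivisionRing F where
  /-- The topology of a local field is not discrete. -/
  not_discrete : ¬ DiscreteTopology F

/-! ### Non-archimedean local fields: residue cardinality and normalised absolute value -/

namespace IsNonarchimedeanLocalField

section Basic

variable (F : Type*) [Field F] [ValuativeRel F] [TopologicalSpace F]
  [IsNonarchimedeanLocalField F]

/-- The cardinality `q_F` of the (finite) residue field `𝓀[F]` of a non-archimedean local
field `F` (Serre, *Local Fields*, Ch. II §1; Cassels–Fröhlich Ch. II §7). [folklore] -/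
noncomputable def residueFieldCard : ℕ := Nat.card 𝓀[F]

/-- `q_F > 1`: the residue field of a non-archimedean local field has at least two elements
(Serre, *Local Fields*, Ch. II §1). [folklore] -/
theorem one_lt_residueFieldCard : 1 < residueFieldCard F :=
  Finite.one_lt_card

/-- `q_F ≠ 0`. [folklore] -/
theorem residueFieldCard_ne_zero : residueFieldCard F ≠ 0 :=
  (Nat.zero_lt_one.trans (one_lt_residueFieldCard F)).ne'

/-- `q_F` is a prime power (the residue field is a finite field; Serre, *Local Fields*,
Ch. II §1). [folklore] -/
theorem isPrimePow_residueFieldCard : IsPrimePow (residueFieldCard F) := by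
  classical
  letI := Fintype.ofFinite 𝓀[F]
  rw [residueFieldCard, Nat.card_eq_fintype_card]
  exact FiniteField.isPrimePow_card _

/-- `q_F = p ^ f` where `p = ringChar 𝓀[F]` is the residue characteristic and `f ≥ 1`
(Serre, *Local Fields*, Ch. II §1). [folklore] -/
theorem residueFieldCard_eq_pow_ringChar :
    ∃ f : ℕ, 0 < f ∧ residueFieldCard F = ringChar 𝓀[F] ^ f := by
  classical
  letI := Fintype.ofFinite 𝓀[F]
  obtain ⟨n, -, hn⟩ := FiniteField.card 𝓀[F] (ringChar 𝓀[F])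
  exact ⟨n, n.pos, by rw [residueFieldCard, Nat.card_eq_fintype_card, hn]⟩

/-- The normalised absolute value `|·|_F : F →*₀ ℝ≥0` of a non-archimedean local field:
`|x|_F = q_F ^ (-v_F x)` where `v_F` is the normalised (surjective onto `ℤ`) additive valuation,
so that `|ϖ|_F = q_F⁻¹` for a uniformizer `ϖ` and `d(ax) = |a|_F dx` for a Haar measure `dx`
(Tate, Corvallis 1979, (1.4.1); Cassels–Fröhlich Ch. II §7; Weil 1967 Ch. I §2). Built from
Mathlib's `IsNonarchimedeanLocalField.valueGroupWithZeroIsoInt` and `WithZeroMulInt.toNNReal`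
with base `q_F`. [cite: Corvallis1979, (1.4.1] -/
noncomputable def normAbs : F →*₀ ℝ≥0 :=
  (WithZeroMulInt.toNNReal (e := (residueFieldCard F : ℝ≥0))
      (Nat.cast_ne_zero.mpr (residueFieldCard_ne_zero F))).comp
    ((_root_.IsNonarchimedeanLocalField.valueGroupWithZeroIsoInt
        F).toMulEquiv.toMonoidWithZeroHom.comp (valuation F).toMonoidWithZeroHom)

variable {F}

/-- Unfolding lemma for `normAbs`. [folklore] -/
theorem normAbs_apply (x : F) :
    normAbs F x = WithZeroMulInt.toNNReal (Nat.cast_ne_zero.mpr (residueFieldCard_ne_zero F))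
      (_root_.IsNonarchimedeanLocalField.valueGroupWithZeroIsoInt F (valuation F x)) :=
  rfl

/-- `|x|_F ≤ 1 ↔ x ∈ 𝒪[F]`: the closed unit ball of the normalised absolute value is the
valuation ring (Cassels–Fröhlich Ch. II §7). [folklore] -/
@[simp]
theorem normAbs_le_one_iff {x : F} : normAbs F x ≤ 1 ↔ x ∈ 𝒪[F] := by
  rw [normAbs_apply, WithZeroMulInt.toNNReal_le_one_iff
    (by exact_mod_cast one_lt_residueFieldCard F), ← map_one
    (_root_.IsNonarchimedeanLocalField.valueGroupWithZeroIsoInt F), map_le_map_iff,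
    Valuation.mem_integer_iff]

/-- `|x|_F < 1 ↔ v(x) < 1`: the open unit ball of the normalised absolute value is the set of
elements of (canonical) valuation `< 1` (Cassels–Fröhlich Ch. II §7). See
`normAbs_lt_one_iff_mem_maximalIdeal` for the version `↔ x ∈ 𝓂[F]` on `x : 𝒪[F]`. [folklore] -/
@[simp]
theorem normAbs_lt_one_iff {x : F} : normAbs F x < 1 ↔ valuation F x < 1 := by
  rw [normAbs_apply, WithZeroMulInt.toNNReal_lt_one_iff
    (by exact_mod_cast one_lt_residueFieldCard F), ← map_one
    (_root_.IsNonarchimedeanLocalField.valueGroupWithZeroIsoInt F), map_lt_map_iff]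

/-- `|x|_F < 1 ↔ x ∈ 𝓂[F]` for `x ∈ 𝒪[F]`: the open unit ball is the maximal ideal of the
valuation ring (Cassels–Fröhlich Ch. II §7). [folklore] -/
theorem normAbs_lt_one_iff_mem_maximalIdeal {x : 𝒪[F]} : normAbs F x < 1 ↔ x ∈ 𝓂[F] := by
  rw [normAbs_lt_one_iff, IsLocalRing.mem_maximalIdeal, mem_nonunits_iff,
    Valuation.Integer.not_isUnit_iff_valuation_lt_one]

/-- `|ϖ|_F = q_F⁻¹` for a uniformizer `ϖ` (Tate, Corvallis 1979, (1.4.1);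
Cassels–Fröhlich Ch. II §7). [cite: Corvallis1979, (1.4.1] -/
def normAbs_uniformizer : Prop :=
  ∀ {ϖ : F} (hϖ : (valuation F).IsUniformizer ϖ),
    normAbs F ϖ = (residueFieldCard F : ℝ≥0)⁻¹

end Basic

/-- Every non-archimedean local field (in Mathlib's sense) is a local field in Weil's sense:
Hausdorff (valuative topologies are), locally compact, a topological division ring, and not
discrete since the valuation is non-trivial (Weil 1967, Ch. I §3–§4). [cite: Weil1967, Ch. I §3–§4] -/
theorem isLocalField (F : Type*) [Field F] [ValuativeRel F] [TopologicalSpace F]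
    [IsNonarchimedeanLocalField F] : IsLocalField F := by
  haveI : T2Space F := by
    apply IsTopologicalAddGroup.t2Space_of_zero_sep
    intro x hx
    refine ⟨{ z | valuation F z < valuation F x }, ?_, by simp⟩
    rw [IsValuativeTopology.mem_nhds_zero_iff]
    exact ⟨Units.mk0 (valuation F x) (by simpa using hx), subset_rfl⟩
  refine ⟨fun h ↦ ?_⟩
  have h0 : ({0} : Set F) ∈ nhds (0 : F) := (discreteTopology_iff_singleton_mem_nhds.mp h) 0
  obtain ⟨γ, hγ⟩ := (IsValuativeTopology.mem_nhds_zero_iff _).mp h0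
  obtain ⟨y, hy0, hy1⟩ := Valuation.IsNontrivial.exists_lt_one (v := valuation F)
  obtain ⟨g, hg⟩ := ValuativeRel.valuation_surjective (γ : ValueGroupWithZero F)
  have hg0 : g ≠ 0 := by rintro rfl; exact γ.ne_zero (by simpa using hg.symm)
  have hlt : valuation F (g * y) < γ := by
    rw [map_mul, hg]; exact mul_lt_of_lt_one_right (by simp) hy1
  have := hγ hlt
  simp [hg0, hy0] at this

end IsNonarchimedeanLocalField

/-! ### Archimedean examples and `ℚ_[p]` -/

namespace IsLocalField

/-- `ℝ` is a local field (Weil 1967, Ch. I §3). [cite: Weil1967, Ch. I §3] -/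
theorem real : IsLocalField ℝ where
  not_discrete h := by
    have : IsOpen ({0} : Set ℝ) := isOpen_discrete _
    obtain ⟨ε, hε, hball⟩ := Metric.isOpen_iff.mp this 0 rfl
    have hmem : (ε / 2 : ℝ) ∈ Metric.ball (0 : ℝ) ε := by
      rw [Metric.mem_ball, Real.dist_eq, sub_zero, abs_of_pos (half_pos hε)]
      exact half_lt_self hε
    exact (half_pos hε).ne' (hball hmem)

/-- `ℂ` is a local field (Weil 1967, Ch. I §3). [cite: Weil1967, Ch. I §3] -/
theorem complex : IsLocalField ℂ where
  not_discrete h := by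
    have : IsOpen ({0} : Set ℂ) := isOpen_discrete _
    obtain ⟨ε, hε, hball⟩ := Metric.isOpen_iff.mp this 0 rfl
    have hmem : ((ε / 2 : ℝ) : ℂ) ∈ Metric.ball (0 : ℂ) ε := by
      rw [Metric.mem_ball, dist_zero_right, Complex.norm_real, Real.norm_eq_abs,
        abs_of_pos (half_pos hε)]
      exact half_lt_self hε
    have := hball hmem
    simp only [Set.mem_singleton_iff, Complex.ofReal_eq_zero] at this
    exact (half_pos hε).ne' this

end IsLocalField

namespace Padic

/-- `ℚ_[p]` is a non-archimedean local field with respect to Mathlib's valuative relation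
`Padic.instValuativeRel` (induced by `Padic.mulValuation`) and its metric topology: the topology
is the valuative one, it is locally compact (`ℤ_[p]` is compact) and the valuation is
non-trivial (Serre, *Local Fields*, Ch. II §1; Gouvêa, *p-adic Numbers*, §3.3). This is the
instantiation witness for the notion `local_field`; deliberately a theorem, not an instance
(outline GalRep D4). [cite: SerreLocalFields1979, Ch. II §1] -/
def isNonarchimedeanLocalField : Prop :=
  ∀ (p : ℕ) [Fact p.Prime],
    IsNonarchimedeanLocalField ℚ_[p]

/-- `ℚ_[p]` is a local field in Weil's sense (Weil 1967, Ch. I §3). [cite: Weil1967, Ch. I §3] -/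
def isLocalField : Prop :=
  ∀ (p : ℕ) [Fact p.Prime],
    IsLocalField ℚ_[p]

end Padic

/-! ### Weil's classification -/

namespace IsLocalField

/-- **Classification of local fields** (Weil, *Basic Number Theory*, 1967, Ch. I §3 Theorem 5
and §4 Theorem 8): a local field `F` is either non-archimedean — there is a valuative relation
on `F` for which `F` (with its given topology) is a non-archimedean local field in Mathlib's
sense — or archimedean, i.e. isomorphic as a topological field to `ℝ` or to `ℂ`. [cite: WeilBNT1967, Ch. I §3 Theorem 5 and §4 Theorem 8] -/
def isNonarchimedean_or_archimedean : Prop :=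
  ∀ (F : Type*) [Field F] [TopologicalSpace F] [IsLocalField F],
    (∃ r : ValuativeRel F, @IsNonarchimedeanLocalField F _ r _) ∨
      (∃ e : F ≃+* ℝ, IsHomeomorph e) ∨ (∃ e : F ≃+* ℂ, IsHomeomorph e)

/-- Classification of local fields (Weil, *Basic Number Theory*, 1967, Ch. I §3 Theorem 5 and §4
Theorem 8), under the name listed in the work item's `planned_decls`; alias of
`IsLocalField.isNonarchimedean_or_archimedean` (the outline's name, GalRep.md C1). [folklore] -/
def nonarchimedean_or_archimedean : Prop :=
  ∀ (F : Type*) [Field F] [TopologicalSpace F] [IsLocalField F],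
    (∃ r : ValuativeRel F, @IsNonarchimedeanLocalField F _ r _) ∨
      (∃ e : F ≃+* ℝ, IsHomeomorph e) ∨ (∃ e : F ≃+* ℂ, IsHomeomorph e)

/- interim proof relied on results that are now named facts (D-0014); demoted to a fact by the M5 import, proof preserved:
:=
  isNonarchimedean_or_archimedean F
-/

end IsLocalField

end Literature.NumberTheory.GaloisRepresentations
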